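import Summits.QuantumFields.BalabanUV.Beta.FP.StepRecursionFeedNestedComp
import Literature.MathematicalPhysics.QuantumFieldTheory.Balaban1983to89.Beta.StepDriftWitness

/-!
# `BalabanUV.Beta.FP.StepRecursionFeedNestedCompUpTo` — road «FP» for binder row D1: **THE ROAD's END AT THE RECORD PAIR, NESTED CURRENCY,
# ON THE PRICED BRANCH** — #31 `StepRecursionFeedNestedComp` with the kernel law carrying a DISPLAYED DEFECT FAMILY `D j` per storey and
# an4's four remainder binders on it (R-FP-56 (b); `HessianTelescopingKKT` §7∕§8 `d1Tel_of_stepRecursionUpTo_wStep`), plus the READ-OUT-LEVEL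
# twin concluding the lead's `StepDriftWitness.D1Sum` (RULING (R27)∕(R28-1)); and the END WITH NO LAW AT ALL: the defect NAMED as
# `hessKer N − hessKer F − hessKer G`, every bit of content in its second-moment invisibility

WHY (SPEC-64 §1 (O3)∕(O4), an2 g74 J-NOTE-18 §2 (c), road g51 A-1 l.68477).  #31's END `d1Tel_JcComp_ctr_nested_of_hessKer_laws_wStep` has NO defect
slot: its `hlaw` row is the EXACT door `hessKer N_j = hessKer F_j + hessKer G_j` at the record's N-system `(AN, VN, WN)` (an2 F6d-2) BY NAME.  A door family fed
as N-data (SPEC-64 (ii-A), N-side placement (O3)) surfaces there as ONE scalar kernel-level defect per storey, `hessKer N_j = hessKer F_j + hessKer G_j + D j`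
with `D j μ ν z := −½·tadpole (AN j) (𝒲Δ∞ j μ 0 ν z)`; (ii-A) displays `D = 0` (`hDΔ`).  WHAT THE BINDER ACTUALLY NEEDS OF `D` is read off the tree:
`D1Tel := HessianTelescoping` is an EXACT second-moment-tensor identity at every one-shot depth `m` (`HidentScalewise` §1), and an4's `StepRecursionUpTo`
machinery (`m2Tensor_step_of_stepRecursionUpTo`, `d1Tel_of_stepRecursionUpTo_wStep`) turns the door WITH a defect into `D1Tel` under FOUR binders on `D j`,
`j ≥ 1`: vanishing zeroth and first decimated moments (`hD0 hD1` — so the one-shot kernels' Ward data are inherited along the recursion), absolutely summable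
second moments (`hDA`) and VANISHING SECOND-MOMENT TENSOR (`hD2 : m2Tensor (D j) = 0`) — NOT `D j = 0` entrywise.  At the read-out level (the lead's `D1Sum`,
the (1.22) channel `(μ, ν)`) only `hDF : secondMoment (D j) μ ν = 0` (`secondMomentSum_of_stepRecursionUpTo_wStep`).  The road's #28 §3∕§5 typed this priced
branch at kernel-entry level and at the `JcOf` literal (`d1Tel_of_kernel_laws_upTo_wStep`, `d1Tel_JcOf_of_kernel_laws_upTo_wStep`); this file types it in the
NESTED currency AT THE RECORD PAIR `(Js, Jc) = (JsB12CombShSym …, JcComp …)` — the shape v9's consumer feeds — so that the door fed as data has a typed END to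
land in WHATEVER the by-value gate G2 (the n = 0 door tadpole, entrywise) says: G2 reads `hDΔ`; the END reads `m2Tensor (D 1)` (base) and `m2Tensor (D j)` (steps).

WHAT.  Blocking `Lc` (`[NeZero Lc]`, `Odd Lc`), dimension four, ROOT M‴'s `Js := JsB12CombShSym hLc N (symTablesAn1S2 3 Lc cΛ) cΛ cB` UNCHANGED, `Jc := JcComp hLc N cΛ cB R P`.
* §1 [folklore] **ANCHORED × PRICED at kernel-entry level**: `d1Tel_anchored_of_kernel_laws_upTo_wStep` — #28 §5 `d1Tel_anchored_of_kernel_laws_wStep` (any `Jc`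
  anchored at `m = 1` on `JcOf`) with the door carrying `+ D j` and an4's `hD0 hD1 hDA hD2` ⟹ `D1Tel`; `d1Sum_anchored_of_kernel_laws_upTo_wStep` — the same with
  `hDF` in place of `hD2` ⟹ `D1Sum … μ ν` (an4 §9 `secondMomentSum_of_stepRecursionUpTo_wStep` + `StepDriftWitness.d1Sum_iff`).
* §2 [folklore] **THE NESTED END ON THE PRICED BRANCH AT THE RECORD PAIR**: `d1Tel_JcComp_nested_of_hessKer_laws_upTo_wStep` (+ `_ctr` at `Roots.ctr Lc`) — #31's
  rows VERBATIM (`hF₁`, `htr`, `hG`, (T0)(T1); `hN := hN_JcComp`, `hJc1 := JcComp_one`) with `hlaw` now `hessKer N_j = hessKer F_j + hessKer G_j + D j μ ν z` and the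
  four binders on `D` ⟹ `D1Tel Lc Js (JcComp …)`; `d1Sum_JcComp_nested_of_hessKer_laws_upTo_wStep` (+ `_ctr`) — `hDF` in place of `hD2` ⟹ `D1Sum Lc Js (JcComp …) μ ν`.
* §3 [folklore] **NO LAW — THE DEFECT NAMED**: `d1Tel_JcComp_ctr_nested_of_defect_invisible` ∕ `d1Sum_JcComp_ctr_nested_of_defect_invisible` — with
  `D j μ ν z := hessKer N_j μ ν z − hessKer F_j μ ν z − hessKer G_j μ ν z` the law holds FOR FREE (#28 §1 `stepRecursionUpTo_of_identifications` pattern), so the END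
  reads: `hF₁ htr hG` (T0)(T1) + the four (resp. read-out) binders ON THAT NAMED DEFECT ⟹ `D1Tel` (resp. `D1Sum`).  This is the honest bottom line of SPEC-64 §1
  for the binder: every bit of (L1)'s content the END consumes is the second-moment invisibility of `hessKer N^rec − hessKer F − hessKer G`.
[folklore] composition BY NAME (an4's §7–§9 theorems, #28 §1∕§5, #42b §1 `fineId_of_transport_of_oneShotId`, an2 F6d-2 `hN_JcComp ∕ TshotOf_JcComp_one`); no `def`,
no `def … : Prop`, nothing cited, 0 sorry.  Every displayed row is a HYPOTHESIS; nothing of the dictionary ∕ Bałaban's asserted, valued or discharged; NO defect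
claimed to vanish or to be invisible (by value the n = 0 door tadpole is being measured ENTRYWISE by Engine C's K2L-DTAD, zero weight; its second-moment tensor is
unmeasured); `D1Tel ∕ D1Sum` CONCLUDED here only from displayed rows; the target `D1Tel` is UNCHANGED (SPEC-64 (ii-D) — a target WITH a defect slot — is NOT typed).
CONSUMERS: a v10-class wrapper feeding the door family as N-data (SPEC-64 (ii-A), on the referee's word) can hand `hlaw` its exact shape from `TowerKernelLawNamedC`
+ `WSlotSplit.hessKer_add_W` with `D := −DΔ` and DISPLAY `hD0 hD1 hDA hD2` (or `hDF`) instead of `hDΔ`; nothing else changes.  No existing file touched.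

HONEST DEPENDENCY (page 1, mandatory): continuum YM on T⁴ ⇐ BetaPertH ∧ nine spine estimates (0/9 proved); BetaPertH ⇐ (D1) ∧ (D4) ∧ CAP+tail;
G-an2-4 gates asym, D1 and NE2/3/4.  HONEST FRAMING (cell contract, verbatim): «discharging `BetaPertH` makes Bałaban's UV stability UNCONDITIONAL —
a real constructive-QFT result; it is NOT the continuum limit and NOT the Clay problem.»  ABSOLUTE RULE (cell charter, verbatim): «No internally-minted
statement may enter as a cited fact. Every hypothesis is either kernel-proved in this package or a verbatim quotation of a PUBLISHED theorem with page
reference. The manuscript(s) under audit are NOT citable for their own disputed steps — they are the thing under adjudication; programme-internal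
(2001/route/tribunal) claims are never citable.»  0 estimates; 0∕4 row-D1 binders (hW, hR, D1Tel, D1Rep); ROOT M‴ p325680 untouched; NOT (C1), NOT (L2′)
beyond `hN`'s name, NOT (T-ID), NOT SDF, NOT D1, NEVER «G-an2-4 closed», NOT BetaPertH, NOT continuum, NOT Clay.  Road «FP» OWNER, b2b-balaban-beta-d1-p3
gen 51, 2026-08-28.  No existing file touched.
-/

noncomputable section

namespace Summit.QuantumFields.BalabanUV.Beta.FP.StepRecursionFeedNestedCompUpTo

open Finset
open Literature.MathematicalPhysics.QuantumFieldTheory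
open Literature.MathematicalPhysics.QuantumFieldTheory.Balaban1983to89
open Literature.MathematicalPhysics.QuantumFieldTheory.Balaban1983to89.Beta
open Literature.MathematicalPhysics.QuantumFieldTheory.Balaban1983to89.B12Beta (secondMoment)
open DecimatedMomentSummable (AbsMoment₂)
open DressedMomentNormalisation (EKer dressedEntry m2Tensor)
open ExpKernelCalculus (MKer hessKer)
open OneStepResolventKernel (Fib JetData)
open OneStepKernelFamily (TshotOf TbalOf D1Tel)
open HessianTelescopingKKT (StepRecursionUpTo wStep d1Tel_of_stepRecursionUpTo_wStep secondMomentSum_of_stepRecursionUpTo_wStep)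
open StepDriftWitness (D1Sum)
open Summit.QuantumFields.BalabanUV.Beta.SymSecondOrderTablesAn1 (symTablesAn1S2)
open Summit.QuantumFields.BalabanUV.Beta.CombChartJointEnd (JsB12CombShSym)
open Summit.QuantumFields.BalabanUV.Beta.CombOneShotJets (JcOf TshotOf_JcOf_one)
open Summit.QuantumFields.BalabanUV.Beta.FP.StepRecursionFeed (stepRecursionUpTo_of_kernel_laws)
open Summit.QuantumFields.BalabanUV.Beta.FP.StepRecursionFeedNested (fineId_of_transport_of_oneShotId)
open Summit.QuantumFields.BalabanUV.Beta.CompositeOneShotJetData (Roots Pins JcComp JcComp_one AN VN WN hN_JcComp)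

/-! ## §1 Anchored × priced, kernel-entry level: any `Jc` anchored at `m = 1` on `JcOf`, the door WITH a defect family -/

section Anchored

variable {Lc : ℕ} [NeZero Lc]

/-- [folklore] **`D1Tel` AT M‴'s LITERAL FOR ANY COMPOSITE FAMILY ANCHORED AT `m = 1`, ON THE PRICED BRANCH** (#28 §5 `d1Tel_anchored_of_kernel_laws_wStep` ×
R-FP-56 (b)): for ANY `Jc` whose depth-1 member IS `JcOf`'s (`hJc1`), the de-periodised door per `j ≥ 1` WITH a displayed defect family `D j`
(`𝒦N = 𝒦F + 𝒦G + D`), the identifications `hN hF hG` at the canonical weight, (T0)(T1) of the step kernels, and an4's four remainder binders on `D`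
(`hD0 hD1` vanishing zeroth∕first decimated moments, `hDA` absolutely summable second moments, `hD2` VANISHING SECOND-MOMENT TENSOR, `j ≥ 1`)
⟹ `D1Tel Lc (JsB12CombShSym …) Jc`; `hbase` discharged through the anchor and an2's `TshotOf_JcOf_one`. -/
theorem d1Tel_anchored_of_kernel_laws_upTo_wStep (hLc : Odd Lc) (N : ℕ) (cΛ cB : ℝ) (Jc : ∀ m : ℕ, JetData 3 (Lc ^ m))
    (hJc1 : Jc 1 = JcOf hLc N (fun _ => cΛ) (fun _ => cB) 1) (𝒦N 𝒦F 𝒦G D : ℕ → EKer 4)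
    (hlaw : ∀ j : ℕ, 1 ≤ j → ∀ (a b : Fin 4) (z : Fin 4 → ℤ), 𝒦N j a b z = 𝒦F j a b z + 𝒦G j a b z + D j a b z)
    (hN : ∀ j : ℕ, 1 ≤ j → ∀ (a b : Fin 4) (z : Fin 4 → ℤ), 𝒦N j a b z = TshotOf Lc Jc (j + 1) a b z)
    (hF : ∀ j : ℕ, 1 ≤ j → ∀ (a b : Fin 4) (z : Fin 4 → ℤ),
      𝒦F j a b z = (Lc : ℝ) ^ 8 * dressedEntry (wStep Lc j) (TshotOf Lc Jc j) ((Lc : ℤ) • z) a b)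
    (hG : ∀ j : ℕ, 1 ≤ j → ∀ (a b : Fin 4) (z : Fin 4 → ℤ),
      𝒦G j a b z = TbalOf Lc (JsB12CombShSym hLc N (symTablesAn1S2 3 Lc cΛ) cΛ cB) j a b z)
    (hT0 : ∀ j (c e : Fin 4), HasSum (TbalOf Lc (JsB12CombShSym hLc N (symTablesAn1S2 3 Lc cΛ) cΛ cB) j c e) 0)
    (hT1 : ∀ j (c e ρ : Fin 4), HasSum (fun t : Fin 4 → ℤ => t ρ • TbalOf Lc (JsB12CombShSym hLc N (symTablesAn1S2 3 Lc cΛ) cΛ cB) j c e t) 0)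
    (hD0 : ∀ j, 1 ≤ j → ∀ c e : Fin 4, HasSum (D j c e) 0)
    (hD1 : ∀ j, 1 ≤ j → ∀ c e ρ : Fin 4, HasSum (fun t : Fin 4 → ℤ => t ρ • D j c e t) 0)
    (hDA : ∀ j, 1 ≤ j → ∀ c e : Fin 4, AbsMoment₂ (D j c e)) (hD2 : ∀ j, 1 ≤ j → m2Tensor (D j) = 0) :
    D1Tel Lc (JsB12CombShSym hLc N (symTablesAn1S2 3 Lc cΛ) cΛ cB) Jc := by
  have hbase : TshotOf Lc Jc 1 = TbalOf Lc (JsB12CombShSym hLc N (symTablesAn1S2 3 Lc cΛ) cΛ cB) 0 := by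
    have h1 : TshotOf Lc Jc 1 = TshotOf Lc (JcOf hLc N (fun _ => cΛ) (fun _ => cB)) 1 := by
      show OneStepResolventKernel.TOf (N := Lc ^ 1) (Jc 1) = OneStepResolventKernel.TOf (N := Lc ^ 1) (JcOf hLc N (fun _ => cΛ) (fun _ => cB) 1)
      rw [hJc1]
    exact h1.trans (TshotOf_JcOf_one hLc N (fun _ => cΛ) (fun _ => cB))
  exact d1Tel_of_stepRecursionUpTo_wStep _ Jc hT0 hT1 hD0 hD1 hDA hD2 hbase
    (stepRecursionUpTo_of_kernel_laws 𝒦N 𝒦F 𝒦G D hlaw hN hF hG)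

/-- [folklore] **THE READ-OUT-LEVEL TWIN** (RULING (R27)∕(R28-1): the telescoping binder cut at the (1.22) read-out, channel `(μ, ν)`): the same rows with
`hD2` REPLACED by `hDF : secondMoment (D j) μ ν = 0` (`j ≥ 1`) ⟹ the lead's `StepDriftWitness.D1Sum Lc (JsB12CombShSym …) Jc μ ν` — an4 §9
`secondMomentSum_of_stepRecursionUpTo_wStep` read through `d1Sum_iff` (`Iff.rfl`). -/
theorem d1Sum_anchored_of_kernel_laws_upTo_wStep (hLc : Odd Lc) (N : ℕ) (cΛ cB : ℝ) (Jc : ∀ m : ℕ, JetData 3 (Lc ^ m))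
    (hJc1 : Jc 1 = JcOf hLc N (fun _ => cΛ) (fun _ => cB) 1) (𝒦N 𝒦F 𝒦G D : ℕ → EKer 4) (μ ν : Fin 4)
    (hlaw : ∀ j : ℕ, 1 ≤ j → ∀ (a b : Fin 4) (z : Fin 4 → ℤ), 𝒦N j a b z = 𝒦F j a b z + 𝒦G j a b z + D j a b z)
    (hN : ∀ j : ℕ, 1 ≤ j → ∀ (a b : Fin 4) (z : Fin 4 → ℤ), 𝒦N j a b z = TshotOf Lc Jc (j + 1) a b z)
    (hF : ∀ j : ℕ, 1 ≤ j → ∀ (a b : Fin 4) (z : Fin 4 → ℤ),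
      𝒦F j a b z = (Lc : ℝ) ^ 8 * dressedEntry (wStep Lc j) (TshotOf Lc Jc j) ((Lc : ℤ) • z) a b)
    (hG : ∀ j : ℕ, 1 ≤ j → ∀ (a b : Fin 4) (z : Fin 4 → ℤ),
      𝒦G j a b z = TbalOf Lc (JsB12CombShSym hLc N (symTablesAn1S2 3 Lc cΛ) cΛ cB) j a b z)
    (hT0 : ∀ j (c e : Fin 4), HasSum (TbalOf Lc (JsB12CombShSym hLc N (symTablesAn1S2 3 Lc cΛ) cΛ cB) j c e) 0)
    (hT1 : ∀ j (c e ρ : Fin 4), HasSum (fun t : Fin 4 → ℤ => t ρ • TbalOf Lc (JsB12CombShSym hLc N (symTablesAn1S2 3 Lc cΛ) cΛ cB) j c e t) 0)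
    (hD0 : ∀ j, 1 ≤ j → ∀ c e : Fin 4, HasSum (D j c e) 0)
    (hD1 : ∀ j, 1 ≤ j → ∀ c e ρ : Fin 4, HasSum (fun t : Fin 4 → ℤ => t ρ • D j c e t) 0)
    (hDA : ∀ j, 1 ≤ j → ∀ c e : Fin 4, AbsMoment₂ (D j c e)) (hDF : ∀ j, 1 ≤ j → secondMoment (D j) μ ν = 0) :
    D1Sum Lc (JsB12CombShSym hLc N (symTablesAn1S2 3 Lc cΛ) cΛ cB) Jc μ ν := by
  have hbase : TshotOf Lc Jc 1 = TbalOf Lc (JsB12CombShSym hLc N (symTablesAn1S2 3 Lc cΛ) cΛ cB) 0 := by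
    have h1 : TshotOf Lc Jc 1 = TshotOf Lc (JcOf hLc N (fun _ => cΛ) (fun _ => cB)) 1 := by
      show OneStepResolventKernel.TOf (N := Lc ^ 1) (Jc 1) = OneStepResolventKernel.TOf (N := Lc ^ 1) (JcOf hLc N (fun _ => cΛ) (fun _ => cB) 1)
      rw [hJc1]
    exact h1.trans (TshotOf_JcOf_one hLc N (fun _ => cΛ) (fun _ => cB))
  rw [StepDriftWitness.d1Sum_iff]
  exact secondMomentSum_of_stepRecursionUpTo_wStep _ Jc μ ν hT0 hT1 hD0 hD1 hDA hDF hbase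
    (stepRecursionUpTo_of_kernel_laws 𝒦N 𝒦F 𝒦G D hlaw hN hF hG)

end Anchored

/-! ## §2 The nested END on the priced branch at the record pair `(Js, JcComp)`, `hN` by name -/

section Nested

variable {Lc : ℕ} [NeZero Lc] {FF FG : Type*} [Fintype FF] [Fintype FG]

/-- [folklore] **ROOT M‴'s `htel` AT THE RECORD PAIR, NESTED CURRENCY, ON THE PRICED BRANCH.**  #31 `d1Tel_JcComp_nested_of_hessKer_laws_wStep` with the
kernel law per storey `j ≥ 1` carrying a DISPLAYED defect family `D j` (`hlaw : hessKer N_j = hessKer F_j + hessKer G_j + D j μ ν z` at an2's N-system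
`(AN R j, VN R P j, WN R P j)`), the ANCHOR storey's fine identification `hF₁`, the TRANSPORT clause `htr`, the top-step identification `hG`, (T0)(T1)
— VERBATIM — and an4's four remainder binders on `D` (`hD0 hD1 hDA hD2`, `j ≥ 1`) ⟹ `D1Tel Lc Js (JcComp hLc N cΛ cB R P)`; `hN := hN_JcComp`,
`hJc1 := JcComp_one`.  `D := 0` is #31. -/
theorem d1Tel_JcComp_nested_of_hessKer_laws_upTo_wStep (hLc : Odd Lc) (N : ℕ) (cΛ cB : ℝ) (R : Roots Lc) (P : Pins)
    (AF : ℕ → MKer 4 FF) (𝒱F : ℕ → Fin 4 → (Fin 4 → ℤ) → MKer 4 FF) (𝒲F : ℕ → Fin 4 → (Fin 4 → ℤ) → Fin 4 → (Fin 4 → ℤ) → MKer 4 FF)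
    (AG : ℕ → MKer 4 FG) (𝒱G : ℕ → Fin 4 → (Fin 4 → ℤ) → MKer 4 FG) (𝒲G : ℕ → Fin 4 → (Fin 4 → ℤ) → Fin 4 → (Fin 4 → ℤ) → MKer 4 FG)
    (D : ℕ → EKer 4)
    (hlaw : ∀ j : ℕ, 1 ≤ j → ∀ (μ ν : Fin 4) (z : Fin 4 → ℤ),
      hessKer (AN R j) (VN R P j) (WN R P j) μ ν z
        = hessKer (AF j) (𝒱F j) (𝒲F j) μ ν z + hessKer (AG j) (𝒱G j) (𝒲G j) μ ν z + D j μ ν z)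
    (hF₁ : ∀ (μ ν : Fin 4) (z : Fin 4 → ℤ),
      hessKer (AF 1) (𝒱F 1) (𝒲F 1) μ ν z
        = (Lc : ℝ) ^ 8 * dressedEntry (wStep Lc 1) (TshotOf Lc (JcComp hLc N cΛ cB R P) 1) ((Lc : ℤ) • z) μ ν)
    (htr : ∀ j : ℕ, 1 ≤ j → ∀ (μ ν : Fin 4) (z : Fin 4 → ℤ),
      hessKer (AF (j + 1)) (𝒱F (j + 1)) (𝒲F (j + 1)) μ ν z
        = (Lc : ℝ) ^ 8 * dressedEntry (wStep Lc (j + 1)) (hessKer (AN R j) (VN R P j) (WN R P j)) ((Lc : ℤ) • z) μ ν)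
    (hG : ∀ j : ℕ, 1 ≤ j → ∀ (μ ν : Fin 4) (z : Fin 4 → ℤ),
      hessKer (AG j) (𝒱G j) (𝒲G j) μ ν z = TbalOf Lc (JsB12CombShSym hLc N (symTablesAn1S2 3 Lc cΛ) cΛ cB) j μ ν z)
    (hT0 : ∀ j (c e : Fin 4), HasSum (TbalOf Lc (JsB12CombShSym hLc N (symTablesAn1S2 3 Lc cΛ) cΛ cB) j c e) 0)
    (hT1 : ∀ j (c e ρ : Fin 4), HasSum (fun t : Fin 4 → ℤ => t ρ • TbalOf Lc (JsB12CombShSym hLc N (symTablesAn1S2 3 Lc cΛ) cΛ cB) j c e t) 0)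
    (hD0 : ∀ j, 1 ≤ j → ∀ c e : Fin 4, HasSum (D j c e) 0)
    (hD1 : ∀ j, 1 ≤ j → ∀ c e ρ : Fin 4, HasSum (fun t : Fin 4 → ℤ => t ρ • D j c e t) 0)
    (hDA : ∀ j, 1 ≤ j → ∀ c e : Fin 4, AbsMoment₂ (D j c e)) (hD2 : ∀ j, 1 ≤ j → m2Tensor (D j) = 0) :
    D1Tel Lc (JsB12CombShSym hLc N (symTablesAn1S2 3 Lc cΛ) cΛ cB) (JcComp hLc N cΛ cB R P) := by
  refine d1Tel_anchored_of_kernel_laws_upTo_wStep hLc N cΛ cB (JcComp hLc N cΛ cB R P) (JcComp_one hLc N cΛ cB R P)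
    (fun j => hessKer (AN R j) (VN R P j) (WN R P j)) (fun j => hessKer (AF j) (𝒱F j) (𝒲F j)) (fun j => hessKer (AG j) (𝒱G j) (𝒲G j)) D
    hlaw (hN_JcComp hLc N cΛ cB R P) ?_ hG hT0 hT1 hD0 hD1 hDA hD2
  intro j hj
  match j, hj with
  | 1, _ => exact hF₁
  | j + 2, _ =>
    exact fineId_of_transport_of_oneShotId (𝒯 := TshotOf Lc (JcComp hLc N cΛ cB R P)) (w := wStep Lc)
      (fun j => hessKer (AN R j) (VN R P j) (WN R P j)) (fun j => hessKer (AF j) (𝒱F j) (𝒲F j)) (j + 1)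
      (hN_JcComp hLc N cΛ cB R P (j + 1) (Nat.succ_pos j)) (htr (j + 1) (Nat.succ_pos j))

/-- [folklore] **THE (β1) TOWER's INSTANCE** — the same at the CENTRED roots `R := Roots.ctr Lc`. -/
theorem d1Tel_JcComp_ctr_nested_of_hessKer_laws_upTo_wStep (hLc : Odd Lc) (N : ℕ) (cΛ cB : ℝ) (P : Pins)
    (AF : ℕ → MKer 4 FF) (𝒱F : ℕ → Fin 4 → (Fin 4 → ℤ) → MKer 4 FF) (𝒲F : ℕ → Fin 4 → (Fin 4 → ℤ) → Fin 4 → (Fin 4 → ℤ) → MKer 4 FF)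
    (AG : ℕ → MKer 4 FG) (𝒱G : ℕ → Fin 4 → (Fin 4 → ℤ) → MKer 4 FG) (𝒲G : ℕ → Fin 4 → (Fin 4 → ℤ) → Fin 4 → (Fin 4 → ℤ) → MKer 4 FG)
    (D : ℕ → EKer 4)
    (hlaw : ∀ j : ℕ, 1 ≤ j → ∀ (μ ν : Fin 4) (z : Fin 4 → ℤ),
      hessKer (AN (Roots.ctr Lc) j) (VN (Roots.ctr Lc) P j) (WN (Roots.ctr Lc) P j) μ ν z
        = hessKer (AF j) (𝒱F j) (𝒲F j) μ ν z + hessKer (AG j) (𝒱G j) (𝒲G j) μ ν z + D j μ ν z)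
    (hF₁ : ∀ (μ ν : Fin 4) (z : Fin 4 → ℤ),
      hessKer (AF 1) (𝒱F 1) (𝒲F 1) μ ν z
        = (Lc : ℝ) ^ 8 * dressedEntry (wStep Lc 1) (TshotOf Lc (JcComp hLc N cΛ cB (Roots.ctr Lc) P) 1) ((Lc : ℤ) • z) μ ν)
    (htr : ∀ j : ℕ, 1 ≤ j → ∀ (μ ν : Fin 4) (z : Fin 4 → ℤ),
      hessKer (AF (j + 1)) (𝒱F (j + 1)) (𝒲F (j + 1)) μ ν z
        = (Lc : ℝ) ^ 8 * dressedEntry (wStep Lc (j + 1))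
            (hessKer (AN (Roots.ctr Lc) j) (VN (Roots.ctr Lc) P j) (WN (Roots.ctr Lc) P j)) ((Lc : ℤ) • z) μ ν)
    (hG : ∀ j : ℕ, 1 ≤ j → ∀ (μ ν : Fin 4) (z : Fin 4 → ℤ),
      hessKer (AG j) (𝒱G j) (𝒲G j) μ ν z = TbalOf Lc (JsB12CombShSym hLc N (symTablesAn1S2 3 Lc cΛ) cΛ cB) j μ ν z)
    (hT0 : ∀ j (c e : Fin 4), HasSum (TbalOf Lc (JsB12CombShSym hLc N (symTablesAn1S2 3 Lc cΛ) cΛ cB) j c e) 0)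
    (hT1 : ∀ j (c e ρ : Fin 4), HasSum (fun t : Fin 4 → ℤ => t ρ • TbalOf Lc (JsB12CombShSym hLc N (symTablesAn1S2 3 Lc cΛ) cΛ cB) j c e t) 0)
    (hD0 : ∀ j, 1 ≤ j → ∀ c e : Fin 4, HasSum (D j c e) 0)
    (hD1 : ∀ j, 1 ≤ j → ∀ c e ρ : Fin 4, HasSum (fun t : Fin 4 → ℤ => t ρ • D j c e t) 0)
    (hDA : ∀ j, 1 ≤ j → ∀ c e : Fin 4, AbsMoment₂ (D j c e)) (hD2 : ∀ j, 1 ≤ j → m2Tensor (D j) = 0) :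
    D1Tel Lc (JsB12CombShSym hLc N (symTablesAn1S2 3 Lc cΛ) cΛ cB) (JcComp hLc N cΛ cB (Roots.ctr Lc) P) :=
  d1Tel_JcComp_nested_of_hessKer_laws_upTo_wStep hLc N cΛ cB (Roots.ctr Lc) P AF 𝒱F 𝒲F AG 𝒱G 𝒲G D hlaw hF₁ htr hG hT0 hT1 hD0 hD1 hDA hD2

/-- [folklore] **THE READ-OUT-LEVEL END AT THE RECORD PAIR, NESTED CURRENCY, ON THE PRICED BRANCH** (channel `(μ, ν)`): #31's rows with `hlaw` carrying
`+ D j μ ν z` and, on `D`, vanishing zeroth∕first decimated moments, absolutely summable second moments and VANISHING `(μ, ν)` SECOND MOMENT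
`hDF : secondMoment (D j) μ ν = 0` (`j ≥ 1`) ⟹ the lead's `D1Sum Lc Js (JcComp …) μ ν`. -/
theorem d1Sum_JcComp_nested_of_hessKer_laws_upTo_wStep (hLc : Odd Lc) (N : ℕ) (cΛ cB : ℝ) (R : Roots Lc) (P : Pins)
    (AF : ℕ → MKer 4 FF) (𝒱F : ℕ → Fin 4 → (Fin 4 → ℤ) → MKer 4 FF) (𝒲F : ℕ → Fin 4 → (Fin 4 → ℤ) → Fin 4 → (Fin 4 → ℤ) → MKer 4 FF)
    (AG : ℕ → MKer 4 FG) (𝒱G : ℕ → Fin 4 → (Fin 4 → ℤ) → MKer 4 FG) (𝒲G : ℕ → Fin 4 → (Fin 4 → ℤ) → Fin 4 → (Fin 4 → ℤ) → MKer 4 FG)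
    (D : ℕ → EKer 4) (μ ν : Fin 4)
    (hlaw : ∀ j : ℕ, 1 ≤ j → ∀ (μ ν : Fin 4) (z : Fin 4 → ℤ),
      hessKer (AN R j) (VN R P j) (WN R P j) μ ν z
        = hessKer (AF j) (𝒱F j) (𝒲F j) μ ν z + hessKer (AG j) (𝒱G j) (𝒲G j) μ ν z + D j μ ν z)
    (hF₁ : ∀ (μ ν : Fin 4) (z : Fin 4 → ℤ),
      hessKer (AF 1) (𝒱F 1) (𝒲F 1) μ ν z
        = (Lc : ℝ) ^ 8 * dressedEntry (wStep Lc 1) (TshotOf Lc (JcComp hLc N cΛ cB R P) 1) ((Lc : ℤ) • z) μ ν)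
    (htr : ∀ j : ℕ, 1 ≤ j → ∀ (μ ν : Fin 4) (z : Fin 4 → ℤ),
      hessKer (AF (j + 1)) (𝒱F (j + 1)) (𝒲F (j + 1)) μ ν z
        = (Lc : ℝ) ^ 8 * dressedEntry (wStep Lc (j + 1)) (hessKer (AN R j) (VN R P j) (WN R P j)) ((Lc : ℤ) • z) μ ν)
    (hG : ∀ j : ℕ, 1 ≤ j → ∀ (μ ν : Fin 4) (z : Fin 4 → ℤ),
      hessKer (AG j) (𝒱G j) (𝒲G j) μ ν z = TbalOf Lc (JsB12CombShSym hLc N (symTablesAn1S2 3 Lc cΛ) cΛ cB) j μ ν z)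
    (hT0 : ∀ j (c e : Fin 4), HasSum (TbalOf Lc (JsB12CombShSym hLc N (symTablesAn1S2 3 Lc cΛ) cΛ cB) j c e) 0)
    (hT1 : ∀ j (c e ρ : Fin 4), HasSum (fun t : Fin 4 → ℤ => t ρ • TbalOf Lc (JsB12CombShSym hLc N (symTablesAn1S2 3 Lc cΛ) cΛ cB) j c e t) 0)
    (hD0 : ∀ j, 1 ≤ j → ∀ c e : Fin 4, HasSum (D j c e) 0)
    (hD1 : ∀ j, 1 ≤ j → ∀ c e ρ : Fin 4, HasSum (fun t : Fin 4 → ℤ => t ρ • D j c e t) 0)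
    (hDA : ∀ j, 1 ≤ j → ∀ c e : Fin 4, AbsMoment₂ (D j c e)) (hDF : ∀ j, 1 ≤ j → secondMoment (D j) μ ν = 0) :
    D1Sum Lc (JsB12CombShSym hLc N (symTablesAn1S2 3 Lc cΛ) cΛ cB) (JcComp hLc N cΛ cB R P) μ ν := by
  refine d1Sum_anchored_of_kernel_laws_upTo_wStep hLc N cΛ cB (JcComp hLc N cΛ cB R P) (JcComp_one hLc N cΛ cB R P)
    (fun j => hessKer (AN R j) (VN R P j) (WN R P j)) (fun j => hessKer (AF j) (𝒱F j) (𝒲F j)) (fun j => hessKer (AG j) (𝒱G j) (𝒲G j)) D μ ν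
    hlaw (hN_JcComp hLc N cΛ cB R P) ?_ hG hT0 hT1 hD0 hD1 hDA hDF
  intro j hj
  match j, hj with
  | 1, _ => exact hF₁
  | j + 2, _ =>
    exact fineId_of_transport_of_oneShotId (𝒯 := TshotOf Lc (JcComp hLc N cΛ cB R P)) (w := wStep Lc)
      (fun j => hessKer (AN R j) (VN R P j) (WN R P j)) (fun j => hessKer (AF j) (𝒱F j) (𝒲F j)) (j + 1)
      (hN_JcComp hLc N cΛ cB R P (j + 1) (Nat.succ_pos j)) (htr (j + 1) (Nat.succ_pos j))

/-- [folklore] The read-out-level END at the CENTRED roots. -/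
theorem d1Sum_JcComp_ctr_nested_of_hessKer_laws_upTo_wStep (hLc : Odd Lc) (N : ℕ) (cΛ cB : ℝ) (P : Pins)
    (AF : ℕ → MKer 4 FF) (𝒱F : ℕ → Fin 4 → (Fin 4 → ℤ) → MKer 4 FF) (𝒲F : ℕ → Fin 4 → (Fin 4 → ℤ) → Fin 4 → (Fin 4 → ℤ) → MKer 4 FF)
    (AG : ℕ → MKer 4 FG) (𝒱G : ℕ → Fin 4 → (Fin 4 → ℤ) → MKer 4 FG) (𝒲G : ℕ → Fin 4 → (Fin 4 → ℤ) → Fin 4 → (Fin 4 → ℤ) → MKer 4 FG)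
    (D : ℕ → EKer 4) (μ ν : Fin 4)
    (hlaw : ∀ j : ℕ, 1 ≤ j → ∀ (μ ν : Fin 4) (z : Fin 4 → ℤ),
      hessKer (AN (Roots.ctr Lc) j) (VN (Roots.ctr Lc) P j) (WN (Roots.ctr Lc) P j) μ ν z
        = hessKer (AF j) (𝒱F j) (𝒲F j) μ ν z + hessKer (AG j) (𝒱G j) (𝒲G j) μ ν z + D j μ ν z)
    (hF₁ : ∀ (μ ν : Fin 4) (z : Fin 4 → ℤ),
      hessKer (AF 1) (𝒱F 1) (𝒲F 1) μ ν z
        = (Lc : ℝ) ^ 8 * dressedEntry (wStep Lc 1) (TshotOf Lc (JcComp hLc N cΛ cB (Roots.ctr Lc) P) 1) ((Lc : ℤ) • z) μ ν)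
    (htr : ∀ j : ℕ, 1 ≤ j → ∀ (μ ν : Fin 4) (z : Fin 4 → ℤ),
      hessKer (AF (j + 1)) (𝒱F (j + 1)) (𝒲F (j + 1)) μ ν z
        = (Lc : ℝ) ^ 8 * dressedEntry (wStep Lc (j + 1))
            (hessKer (AN (Roots.ctr Lc) j) (VN (Roots.ctr Lc) P j) (WN (Roots.ctr Lc) P j)) ((Lc : ℤ) • z) μ ν)
    (hG : ∀ j : ℕ, 1 ≤ j → ∀ (μ ν : Fin 4) (z : Fin 4 → ℤ),
      hessKer (AG j) (𝒱G j) (𝒲G j) μ ν z = TbalOf Lc (JsB12CombShSym hLc N (symTablesAn1S2 3 Lc cΛ) cΛ cB) j μ ν z)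
    (hT0 : ∀ j (c e : Fin 4), HasSum (TbalOf Lc (JsB12CombShSym hLc N (symTablesAn1S2 3 Lc cΛ) cΛ cB) j c e) 0)
    (hT1 : ∀ j (c e ρ : Fin 4), HasSum (fun t : Fin 4 → ℤ => t ρ • TbalOf Lc (JsB12CombShSym hLc N (symTablesAn1S2 3 Lc cΛ) cΛ cB) j c e t) 0)
    (hD0 : ∀ j, 1 ≤ j → ∀ c e : Fin 4, HasSum (D j c e) 0)
    (hD1 : ∀ j, 1 ≤ j → ∀ c e ρ : Fin 4, HasSum (fun t : Fin 4 → ℤ => t ρ • D j c e t) 0)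
    (hDA : ∀ j, 1 ≤ j → ∀ c e : Fin 4, AbsMoment₂ (D j c e)) (hDF : ∀ j, 1 ≤ j → secondMoment (D j) μ ν = 0) :
    D1Sum Lc (JsB12CombShSym hLc N (symTablesAn1S2 3 Lc cΛ) cΛ cB) (JcComp hLc N cΛ cB (Roots.ctr Lc) P) μ ν :=
  d1Sum_JcComp_nested_of_hessKer_laws_upTo_wStep hLc N cΛ cB (Roots.ctr Lc) P AF 𝒱F 𝒲F AG 𝒱G 𝒲G D μ ν hlaw hF₁ htr hG hT0 hT1 hD0 hD1 hDA hDF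

end Nested

/-! ## §3 No law: the defect NAMED — everything the END consumes of (L1) is the second-moment invisibility of `hessKer N − hessKer F − hessKer G` -/

section Named

variable {Lc : ℕ} [NeZero Lc] {FF FG : Type*} [Fintype FF] [Fintype FG]

/-- [folklore] **THE END WITH NO LAW AT ALL** (#28 §1 `stepRecursionUpTo_of_identifications` pattern at the record pair, (β1) instance): name the storey-`j`
defect `D j μ ν z := hessKer N_j μ ν z − hessKer F_j μ ν z − hessKer G_j μ ν z` (the door holds modulo it FOR FREE); then `hF₁ htr hG` (T0)(T1) and an4's
four remainder binders ON THAT NAMED DEFECT ⟹ `D1Tel Lc Js (JcComp … (Roots.ctr Lc) P)`.  Exact door (#31) = the case the named defect is `0`; door as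
data (SPEC-64 (ii-A)) = the case it is `−½·tadpole (AN j) (𝒲Δ∞ j μ 0 ν ·)`; in every case the binder asks only `hD0 hD1 hDA hD2` of it. -/
theorem d1Tel_JcComp_ctr_nested_of_defect_invisible (hLc : Odd Lc) (N : ℕ) (cΛ cB : ℝ) (P : Pins)
    (AF : ℕ → MKer 4 FF) (𝒱F : ℕ → Fin 4 → (Fin 4 → ℤ) → MKer 4 FF) (𝒲F : ℕ → Fin 4 → (Fin 4 → ℤ) → Fin 4 → (Fin 4 → ℤ) → MKer 4 FF)
    (AG : ℕ → MKer 4 FG) (𝒱G : ℕ → Fin 4 → (Fin 4 → ℤ) → MKer 4 FG) (𝒲G : ℕ → Fin 4 → (Fin 4 → ℤ) → Fin 4 → (Fin 4 → ℤ) → MKer 4 FG)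
    (hF₁ : ∀ (μ ν : Fin 4) (z : Fin 4 → ℤ),
      hessKer (AF 1) (𝒱F 1) (𝒲F 1) μ ν z
        = (Lc : ℝ) ^ 8 * dressedEntry (wStep Lc 1) (TshotOf Lc (JcComp hLc N cΛ cB (Roots.ctr Lc) P) 1) ((Lc : ℤ) • z) μ ν)
    (htr : ∀ j : ℕ, 1 ≤ j → ∀ (μ ν : Fin 4) (z : Fin 4 → ℤ),
      hessKer (AF (j + 1)) (𝒱F (j + 1)) (𝒲F (j + 1)) μ ν z
        = (Lc : ℝ) ^ 8 * dressedEntry (wStep Lc (j + 1))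
            (hessKer (AN (Roots.ctr Lc) j) (VN (Roots.ctr Lc) P j) (WN (Roots.ctr Lc) P j)) ((Lc : ℤ) • z) μ ν)
    (hG : ∀ j : ℕ, 1 ≤ j → ∀ (μ ν : Fin 4) (z : Fin 4 → ℤ),
      hessKer (AG j) (𝒱G j) (𝒲G j) μ ν z = TbalOf Lc (JsB12CombShSym hLc N (symTablesAn1S2 3 Lc cΛ) cΛ cB) j μ ν z)
    (hT0 : ∀ j (c e : Fin 4), HasSum (TbalOf Lc (JsB12CombShSym hLc N (symTablesAn1S2 3 Lc cΛ) cΛ cB) j c e) 0)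
    (hT1 : ∀ j (c e ρ : Fin 4), HasSum (fun t : Fin 4 → ℤ => t ρ • TbalOf Lc (JsB12CombShSym hLc N (symTablesAn1S2 3 Lc cΛ) cΛ cB) j c e t) 0)
    (hD0 : ∀ j, 1 ≤ j → ∀ c e : Fin 4, HasSum (fun z : Fin 4 → ℤ =>
      hessKer (AN (Roots.ctr Lc) j) (VN (Roots.ctr Lc) P j) (WN (Roots.ctr Lc) P j) c e z
        - hessKer (AF j) (𝒱F j) (𝒲F j) c e z - hessKer (AG j) (𝒱G j) (𝒲G j) c e z) 0)
    (hD1 : ∀ j, 1 ≤ j → ∀ c e ρ : Fin 4, HasSum (fun z : Fin 4 → ℤ => z ρ •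
      (hessKer (AN (Roots.ctr Lc) j) (VN (Roots.ctr Lc) P j) (WN (Roots.ctr Lc) P j) c e z
        - hessKer (AF j) (𝒱F j) (𝒲F j) c e z - hessKer (AG j) (𝒱G j) (𝒲G j) c e z)) 0)
    (hDA : ∀ j, 1 ≤ j → ∀ c e : Fin 4, AbsMoment₂ (fun z : Fin 4 → ℤ =>
      hessKer (AN (Roots.ctr Lc) j) (VN (Roots.ctr Lc) P j) (WN (Roots.ctr Lc) P j) c e z
        - hessKer (AF j) (𝒱F j) (𝒲F j) c e z - hessKer (AG j) (𝒱G j) (𝒲G j) c e z))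
    (hD2 : ∀ j, 1 ≤ j → m2Tensor (fun c e z =>
      hessKer (AN (Roots.ctr Lc) j) (VN (Roots.ctr Lc) P j) (WN (Roots.ctr Lc) P j) c e z
        - hessKer (AF j) (𝒱F j) (𝒲F j) c e z - hessKer (AG j) (𝒱G j) (𝒲G j) c e z) = 0) :
    D1Tel Lc (JsB12CombShSym hLc N (symTablesAn1S2 3 Lc cΛ) cΛ cB) (JcComp hLc N cΛ cB (Roots.ctr Lc) P) :=
  d1Tel_JcComp_ctr_nested_of_hessKer_laws_upTo_wStep hLc N cΛ cB P AF 𝒱F 𝒲F AG 𝒱G 𝒲G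
    (fun j c e z => hessKer (AN (Roots.ctr Lc) j) (VN (Roots.ctr Lc) P j) (WN (Roots.ctr Lc) P j) c e z
      - hessKer (AF j) (𝒱F j) (𝒲F j) c e z - hessKer (AG j) (𝒱G j) (𝒲G j) c e z)
    (fun j _ μ ν z => by ring) hF₁ htr hG hT0 hT1 hD0 hD1 hDA hD2

/-- [folklore] **THE READ-OUT-LEVEL END WITH NO LAW** (channel `(μ, ν)`): the named defect's zeroth∕first decimated moments vanish, its second moments are
absolutely summable and its `(μ, ν)` SECOND MOMENT VANISHES (`j ≥ 1`) ⟹ `D1Sum Lc Js (JcComp … (Roots.ctr Lc) P) μ ν`. -/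
theorem d1Sum_JcComp_ctr_nested_of_defect_invisible (hLc : Odd Lc) (N : ℕ) (cΛ cB : ℝ) (P : Pins)
    (AF : ℕ → MKer 4 FF) (𝒱F : ℕ → Fin 4 → (Fin 4 → ℤ) → MKer 4 FF) (𝒲F : ℕ → Fin 4 → (Fin 4 → ℤ) → Fin 4 → (Fin 4 → ℤ) → MKer 4 FF)
    (AG : ℕ → MKer 4 FG) (𝒱G : ℕ → Fin 4 → (Fin 4 → ℤ) → MKer 4 FG) (𝒲G : ℕ → Fin 4 → (Fin 4 → ℤ) → Fin 4 → (Fin 4 → ℤ) → MKer 4 FG)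
    (μ ν : Fin 4)
    (hF₁ : ∀ (μ ν : Fin 4) (z : Fin 4 → ℤ),
      hessKer (AF 1) (𝒱F 1) (𝒲F 1) μ ν z
        = (Lc : ℝ) ^ 8 * dressedEntry (wStep Lc 1) (TshotOf Lc (JcComp hLc N cΛ cB (Roots.ctr Lc) P) 1) ((Lc : ℤ) • z) μ ν)
    (htr : ∀ j : ℕ, 1 ≤ j → ∀ (μ ν : Fin 4) (z : Fin 4 → ℤ),
      hessKer (AF (j + 1)) (𝒱F (j + 1)) (𝒲F (j + 1)) μ ν z
        = (Lc : ℝ) ^ 8 * dressedEntry (wStep Lc (j + 1))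
            (hessKer (AN (Roots.ctr Lc) j) (VN (Roots.ctr Lc) P j) (WN (Roots.ctr Lc) P j)) ((Lc : ℤ) • z) μ ν)
    (hG : ∀ j : ℕ, 1 ≤ j → ∀ (μ ν : Fin 4) (z : Fin 4 → ℤ),
      hessKer (AG j) (𝒱G j) (𝒲G j) μ ν z = TbalOf Lc (JsB12CombShSym hLc N (symTablesAn1S2 3 Lc cΛ) cΛ cB) j μ ν z)
    (hT0 : ∀ j (c e : Fin 4), HasSum (TbalOf Lc (JsB12CombShSym hLc N (symTablesAn1S2 3 Lc cΛ) cΛ cB) j c e) 0)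
    (hT1 : ∀ j (c e ρ : Fin 4), HasSum (fun t : Fin 4 → ℤ => t ρ • TbalOf Lc (JsB12CombShSym hLc N (symTablesAn1S2 3 Lc cΛ) cΛ cB) j c e t) 0)
    (hD0 : ∀ j, 1 ≤ j → ∀ c e : Fin 4, HasSum (fun z : Fin 4 → ℤ =>
      hessKer (AN (Roots.ctr Lc) j) (VN (Roots.ctr Lc) P j) (WN (Roots.ctr Lc) P j) c e z
        - hessKer (AF j) (𝒱F j) (𝒲F j) c e z - hessKer (AG j) (𝒱G j) (𝒲G j) c e z) 0)
    (hD1 : ∀ j, 1 ≤ j → ∀ c e ρ : Fin 4, HasSum (fun z : Fin 4 → ℤ => z ρ •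
      (hessKer (AN (Roots.ctr Lc) j) (VN (Roots.ctr Lc) P j) (WN (Roots.ctr Lc) P j) c e z
        - hessKer (AF j) (𝒱F j) (𝒲F j) c e z - hessKer (AG j) (𝒱G j) (𝒲G j) c e z)) 0)
    (hDA : ∀ j, 1 ≤ j → ∀ c e : Fin 4, AbsMoment₂ (fun z : Fin 4 → ℤ =>
      hessKer (AN (Roots.ctr Lc) j) (VN (Roots.ctr Lc) P j) (WN (Roots.ctr Lc) P j) c e z
        - hessKer (AF j) (𝒱F j) (𝒲F j) c e z - hessKer (AG j) (𝒱G j) (𝒲G j) c e z))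
    (hDF : ∀ j, 1 ≤ j → secondMoment (fun c e z =>
      hessKer (AN (Roots.ctr Lc) j) (VN (Roots.ctr Lc) P j) (WN (Roots.ctr Lc) P j) c e z
        - hessKer (AF j) (𝒱F j) (𝒲F j) c e z - hessKer (AG j) (𝒱G j) (𝒲G j) c e z) μ ν = 0) :
    D1Sum Lc (JsB12CombShSym hLc N (symTablesAn1S2 3 Lc cΛ) cΛ cB) (JcComp hLc N cΛ cB (Roots.ctr Lc) P) μ ν :=
  d1Sum_JcComp_ctr_nested_of_hessKer_laws_upTo_wStep hLc N cΛ cB P AF 𝒱F 𝒲F AG 𝒱G 𝒲G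
    (fun j c e z => hessKer (AN (Roots.ctr Lc) j) (VN (Roots.ctr Lc) P j) (WN (Roots.ctr Lc) P j) c e z
      - hessKer (AF j) (𝒱F j) (𝒲F j) c e z - hessKer (AG j) (𝒱G j) (𝒲G j) c e z) μ ν
    (fun j _ μ ν z => by ring) hF₁ htr hG hT0 hT1 hD0 hD1 hDA hDF

end Named

end Summit.QuantumFields.BalabanUV.Beta.FP.StepRecursionFeedNestedCompUpTo

end
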